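import Summits.QuantumFields.YangMills.Theorems.UnitScaleTiltHalvingP1FlatCoreTopStepTorus
import Summits.QuantumFields.YangMills.Theorems.UnitScaleTiltHalvingP1FlatCoreTopStepFamilyTraceFree
import HarnessLib

/-!
# Line H (`BirthV10.stub_halvingStep`, stmt-QuantumFields-19200), τ-thread **(τ-3): THE TRACE-FREE TWIN OF THE TOP-STEP INSTANCE** ✓`P1FlatCoreTopStepTorus.hFP_kLevel_top_RD`
# — the same instantiation of Proposition 5's k-level fixed point at the flat background (N05's lower remainders, the TORUS top member), run through
# ★w7-19936 g8's ✓`HalvingP1FlatCoreTopStep.hFP_kLevel_family_RD_traceFree`, so that the gauge parameter `λ′` is, in addition, `τ`-FREE AT EVERY SITE for a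
# continuous tracial functional `τ` (print: `λ′` is `𝔤`-valued, (1.17) p. 78; for `M₂(ℂ)`, `τ = tr`: traceless, whence `e^{iλ′} ∈ SU(2)` — LEAD-H RULING L-10 [R-f])

Cell `ym3-torus` (HUMAN RULING D-0037: YM₃ on T³ is ladder rung R3, NOT the Clay problem), width seat `ym-ust-19936-w8` gen 3 (LEAD-H L-10 ∕ AMENDMENT: (τ-3) → ★w8).
`--supports stmt-QuantumFields-19200 --as helper`; THEOREMS ONLY (0 `def`, 0 `sorry`); count-neutral; nothing here claims `core′`, `hSupU`, the stub, the crux or the gap.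

WHAT.  ★★★ `hFP_kLevel_top_RD_traceFree` — ✓`hFP_kLevel_top_RD`'s binders VERBATIM (blocks (A)–(E), see that file's docstring) PLUS, at the end, the τ-block in
★w7-19936 g8's letters: `(τ : 𝔸 →L[ℂ] ℂ) (hτtr : τ(xy) = τ(yx))`, the lit base's rows `hDAτ`∕`hRτ`∕`hGτ` (datum, `R`, `G′` `τ`-compatible) at `U₀ = 1`, `hHτ` (`H′` maps
`τ`-free to `τ`-free), `hthτ` (the (o)-target is `τ`-free), and the family's τ-row SPLIT like the family itself: `hCτlo` — N05's `C′_j(u₁⁻¹, ·)` at `j < k` maps `τ`-free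
box data to a `τ`-free value (lit ✓`B8SectETraceFree.sectE_traceFree`'s `hCτ` letters, print's rows below the top); `hTopTrace` — the TORUS top member in torus letters:
for a `τ`-free `l₀` on the fine torus with the tower-box bounds, `τ(log κf[l₀]_k(π_k yc) − (Q′_k l₀)(π_k yc)) = 0` ((τ-1), ★w1-20520 g7: `κ_k(e^{iμ})` has
determinant one ⇒ ✓`trace_mlog_eq_zero_of_det_eq_one`; `siteAvgIter` preserves trace zero).  CONCLUSION: ✓`hFP_kLevel_top_RD`'s with `(∀ x, τ (λ′ x) = 0)` inserted after
the support clause — so STAGE 3b's [R-f] `hlam` (self-adjoint ∧ TRACELESS) closes by `exact` at `τ := Matrix.traceCLM`-type.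
PROOF.  ✓`hFP_kLevel_top_RD`'s lines (the `ℤᵈ`∕torus identifications `h213`, `hlin`, `cj 1 = id`, (S2) at the top, the lower∕top split of `Cfam`∕`Qfull`) with the
socket call replaced by ✓`hFP_kLevel_family_RD_traceFree` and the τ-row of the split family assembled from `hCτlo` (below) and `hTopTrace` (top, through `hrep`).
HONEST SCOPE.  By-name re-run; every analytic and every τ-row stays DISPLAYED (lower: N05's ∕ lit `sectE_traceFree`'s; top: torus letters, (τ-1)); nothing of
[Balaban1985RegularSpaces] Prop. 5 ∕ Sect. E, of `core′`, the stub or the crux is proved here.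

References: T. Bałaban, CMP **99** (1985) 75–102 [Balaban1985RegularSpaces] (Prop. 5 (1.107)–(1.109) p.94, (1.113)–(1.121) pp.95–96, (1.79) p.90, (1.17) p.78);
CMP **98** (1985) 17–51 [Balaban1985Averaging] ((97)–(100) p.32, (208)–(214) p.50, (21) p.21); CMP **102** (1985) 277–309 [Balaban1985Variational] ((156) p.302).
-/

set_option autoImplicit false

noncomputable section

open scoped BigOperators
open NormedSpace Metric Set
open Complex (I)

namespace Summit.QuantumFields.YangMills.Theorems.P1FlatCoreTopStepTorus

open Literature.MathematicalPhysics.QuantumFieldTheory.Balaban1983to89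
open T4Continuum
open MatrixLog (mlog)
open B7Prop1Explicit (e expUnit)
open B7Prop2Explicit (unitaryUnits)
open B7Eq78Linearization (conjR QprimeIter zdBlocking QprimeIter_add QprimeIter_smul)
open B7Eq170Flat (cj cj_apply)
open B7Prop1Local (InBox)
open B8Ineq130 (tlo thi)
open B8Ineq132 (covDerivFwd)
open B8Eq138LandauZd (covLap covDivB QT)
open B8Eq182Proof (gAd)
open B8Eq184Proof (gaugeExp)
open B8Eq188Proof (frakF3)
open B8Eq1117Concrete (XSpace)
open B8LambdaSpaceKLevel (wt)
open B8Prop5ContractionKLevel (Bd2 Mc Kc)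
open B8Eq119TwistedAxial (bgT)
open B8Eq178Averages (Qnl)
open B8Eq1123Concrete (Cnl)
open B15Eq112TorusCover (cover)
open B14DomainGeom (Pt)
open Node00 (coverAt)
open LatticeFieldCalculus (siteAvgIter)
open Literature.MathematicalPhysics.QuantumLattice (blockSites)
open B10Eq27TorusAxialLog (gaugeActT axialT)
open Summit.QuantumFields.YangMills.Theorems.Prop8ChartDoubleBar (vframeU dbarIterU)
open Summit.QuantumFields.YangMills.Theorems.HalvingP1FlatCoreTopStep (hFP_kLevel_family_RD_traceFree)
open Summit.QuantumFields.YangMills.Theorems.P1FlatCoreTopDictionary (siteAvgIter_comp_rep_coverAt_eq_qprimeIter inBox_tlo_thi_iff_mem_blockSites)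

-- `Site` alone could resolve to the torus sites; N05's carriers are `Fin d → ℤ`.
open B7Prop1Explicit (Site)

variable {P : Params} {𝔸 : Type*} [CStarAlgebra 𝔸] [Nontrivial 𝔸]

/-! ## §1 The trace-free top-step instance -/

/-- ★★★ **PROPOSITION 5's TOP STEP FOR THE H-LINE WITH THE TRACE-FREE CLAUSE** — ✓`hFP_kLevel_top_RD` VERBATIM (blocks (A)–(E)) plus the τ-block
(`τ` tracial; datum∕`R`∕`G′`∕`H′`∕target `τ`-rows; the family's τ-row split into N05's lower rows `hCτlo` and the torus top row `hTopTrace`), run through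
✓`HalvingP1FlatCoreTopStep.hFP_kLevel_family_RD_traceFree`.  Output: `λ′` with (sa), support, **`∀ x, τ (λ′ x) = 0`**, (1.108), multiplier form, (lo) and (top).
[cite: Balaban1985RegularSpaces, Prop. 5 (1.107)–(1.109) p.94, (1.113)–(1.121) pp.95–96, (1.79) p.90, (1.17) p.78; Balaban1985Averaging, (97)–(100) p.32, (208)–(214) p.50] -/
theorem hFP_kLevel_top_RD_traceFree {k : ℕ} (hk : k ≤ P.m + P.K) {η : ℝ} {Ω Λs : ℕ → Set (Site P.d)} {Eb : ℕ → Set (Site P.d × Fin P.d)}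
    {A : Site P.d → Fin P.d → 𝔸}
    (hη : 0 < η)
    (hEbΩ : ∀ j, j ≤ k → ∀ x ∈ Ω j, ∀ μ : Fin P.d, (x, μ) ∈ Eb j ∧ (x - e μ, μ) ∈ Eb j)
    (hEbT : ∀ j, j ≤ k → ∀ y ∈ Λs j, ∀ (x : Site P.d) (κ : Fin P.d), InBox (tlo P.L y j) (thi P.L y j) x →
      InBox (tlo P.L y j) (thi P.L y j) (x + e κ) → (x, κ) ∈ Eb j)
    -- (A) letters of [4] (RD form) at the flat background
    (g Δ : (Site P.d → 𝔸) →ₗ[ℂ] (Site P.d → 𝔸)) (q : (Site P.d → 𝔸) →ₗ[ℂ] (ℕ → Site P.d → 𝔸))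
    (qs : (ℕ → Site P.d → 𝔸) →ₗ[ℂ] (Site P.d → 𝔸)) (Aw c : (ℕ → Site P.d → 𝔸) →ₗ[ℂ] (ℕ → Site P.d → 𝔸))
    (g_rightΩ : ∀ x, ∀ y ∈ Ω 0, (Δ (g x) + qs (Aw (q (g x)))) y = x y)
    (c_range : ∀ f, q (g (g (qs (c (q f))))) = q f)
    (hΔ : ∀ (f : Site P.d → 𝔸), ∀ x ∈ Ω 0, Δ f x = covLap η (1 : Site P.d → Fin P.d → 𝔸ˣ) ((Ω 0).indicator f) x)
    (hqs : ∀ (μ : ℕ → Site P.d → 𝔸), ∀ x ∈ Ω 0, qs μ x = QT P.L k Λs (1 : Site P.d → Fin P.d → 𝔸ˣ) μ x)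
    (H' : XSpace P.d k 𝔸 →ₗ[ℂ] (Site P.d → 𝔸))
    {α₄ B₀' B₂' Cb Cl BG BR cA cDA : ℝ}
    (hα₄ : 0 < α₄) (hB : 0 < B₀') (hB₂ : 0 ≤ B₂') (hCb : 0 ≤ Cb) (hCl : 0 ≤ Cl)
    (hH0 : ∀ (X : XSpace P.d k 𝔸) (x : Site P.d), ‖H' X x‖ ≤ B₀' * ‖X‖)
    (hH1 : ∀ j, j ≤ k → ∀ (X : XSpace P.d k 𝔸), ∀ p ∈ Eb j,
      wt P.L η j * ‖covDerivFwd η (1 : Site P.d → Fin P.d → 𝔸ˣ) p.2 (H' X) p.1‖ ≤ B₀' * ‖X‖)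
    (hH2 : ∀ X : XSpace P.d k 𝔸, Bd2 P.L η k Ω (covLap η (1 : Site P.d → Fin P.d → 𝔸ˣ) (H' X)) (B₂' * ‖X‖))
    (hHsupp : ∀ (X : XSpace P.d k 𝔸) (x : Site P.d), x ∉ Ω 0 → H' X x = 0)
    (hHequiv : ∀ X Y : XSpace P.d k 𝔸, (∀ p, Y p = -star (X p)) → ∀ x, H' Y x = -star (H' X x))
    (hCbρ : Cb ≤ α₄ / (2 * B₀')) (hClB : Cl * B₀' ≤ 1 / 2)
    (hBG : 0 ≤ BG) (hBR : 0 ≤ BR) (hcA : 0 ≤ cA) (hcA' : cA ≤ 1 / 13) (hcDA : 0 ≤ cDA)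
    (hG : ∀ (f : Site P.d → 𝔸) (m : ℝ), 0 ≤ m → Bd2 P.L η k Ω f m →
      (∀ x, ‖g f x‖ ≤ BG * m) ∧ ∀ j, j ≤ k → ∀ p ∈ Eb j,
        wt P.L η j * ‖covDerivFwd η (1 : Site P.d → Fin P.d → 𝔸ˣ) p.2 (g f) p.1‖ ≤ BG * m)
    (hGsupp : ∀ (f : Site P.d → 𝔸) (x : Site P.d), x ∉ Ω 0 → g f x = 0)
    (hGreal : ∀ f : Site P.d → 𝔸, (∀ j, j ≤ k → ∀ x ∈ Ω j, IsSelfAdjoint (f x)) → ∀ x, IsSelfAdjoint (g f x))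
    (hRbd : ∀ (f : Site P.d → 𝔸) (m : ℝ), 0 ≤ m → Bd2 P.L η k Ω f m → Bd2 P.L η k Ω (f - g (qs (c (q (g f))))) (BR * m))
    (hRreal : ∀ f : Site P.d → 𝔸, (∀ j, j ≤ k → ∀ x ∈ Ω j, IsSelfAdjoint (f x)) →
      ∀ j, j ≤ k → ∀ x ∈ Ω j, IsSelfAdjoint ((f - g (qs (c (q (g f))))) x))
    (hDA : Bd2 P.L η k Ω (fun y => covDivB η (1 : Site P.d → Fin P.d → 𝔸ˣ) A y) cDA)
    (hDAsa : ∀ j, j ≤ k → ∀ x ∈ Ω j, IsSelfAdjoint (covDivB η (1 : Site P.d → Fin P.d → 𝔸ˣ) A x))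
    (hA : ∀ j, j ≤ k → ∀ x ∈ Ω j, ∀ μ : Fin P.d,
      wt P.L η j * ‖A x μ‖ ≤ cA ∧ wt P.L η j * ‖conjR ((1 : Site P.d → Fin P.d → 𝔸ˣ) (x - e μ) μ)⁻¹ (A (x - e μ) μ)‖ ≤ cA)
    (hAsa : ∀ x μ, IsSelfAdjoint (A x μ))
    -- (B) N05's linear restriction functional: `H′` is its right inverse on the index sites ((1.91)) and JOIN-B's `q` encodes it
    (hQH : ∀ (Y : XSpace P.d k 𝔸) (j : ℕ) (hj : j ≤ k) (y : Site P.d), y ∈ Λs j →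
      QprimeIter (zdBlocking P.d P.L) (bgT P.L (1 : Site P.d → Fin P.d → 𝔸ˣ)) j (H' Y) y = Y (⟨j, Nat.lt_succ_of_le hj⟩, y))
    (hq : ∀ (f : Site P.d → 𝔸) (j : ℕ), j ≤ k → ∀ y ∈ Λs j,
      q f j y = QprimeIter (zdBlocking P.d P.L) (bgT P.L (1 : Site P.d → Fin P.d → 𝔸ˣ)) j f y)
    -- (C) the lower family member: N05's remainder at the inverse lower gauge, rows at `j < k` in the socket's shape
    (u₁ : Site P.d → 𝔸ˣ)
    (hC121lo : ∀ j, j < k → ∀ y ∈ Λs j, ∀ μ : Site P.d → 𝔸,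
      (∀ x : Site P.d, InBox (tlo P.L y j) (thi P.L y j) x → ‖μ x‖ < α₄) →
      (∀ (x : Site P.d) (κ : Fin P.d), InBox (tlo P.L y j) (thi P.L y j) x → InBox (tlo P.L y j) (thi P.L y j) (x + e κ) →
        ‖cj ((1 : Site P.d → Fin P.d → 𝔸ˣ) x κ) (μ (x + e κ)) - μ x‖ < α₄ * ((P.L : ℝ) ^ j)⁻¹) →
      ‖Cnl P.L (1 : Site P.d → Fin P.d → 𝔸ˣ) u₁⁻¹ j μ y‖ ≤ Cb)
    (hC125lo : ∀ j, j < k → ∀ y ∈ Λs j, ∀ (μ₁ μ₂ : Site P.d → 𝔸) (m : ℝ), 0 ≤ m →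
      (∀ x : Site P.d, InBox (tlo P.L y j) (thi P.L y j) x → ‖μ₁ x‖ < α₄) →
      (∀ (x : Site P.d) (κ : Fin P.d), InBox (tlo P.L y j) (thi P.L y j) x → InBox (tlo P.L y j) (thi P.L y j) (x + e κ) →
        ‖cj ((1 : Site P.d → Fin P.d → 𝔸ˣ) x κ) (μ₁ (x + e κ)) - μ₁ x‖ < α₄ * ((P.L : ℝ) ^ j)⁻¹) →
      (∀ x : Site P.d, InBox (tlo P.L y j) (thi P.L y j) x → ‖μ₂ x‖ < α₄) →
      (∀ (x : Site P.d) (κ : Fin P.d), InBox (tlo P.L y j) (thi P.L y j) x → InBox (tlo P.L y j) (thi P.L y j) (x + e κ) →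
        ‖cj ((1 : Site P.d → Fin P.d → 𝔸ˣ) x κ) (μ₂ (x + e κ)) - μ₂ x‖ < α₄ * ((P.L : ℝ) ^ j)⁻¹) →
      (∀ x : Site P.d, InBox (tlo P.L y j) (thi P.L y j) x → ‖(μ₁ - μ₂) x‖ ≤ m) →
      (∀ (x : Site P.d) (κ : Fin P.d), InBox (tlo P.L y j) (thi P.L y j) x → InBox (tlo P.L y j) (thi P.L y j) (x + e κ) →
        ‖cj ((1 : Site P.d → Fin P.d → 𝔸ˣ) x κ) ((μ₁ - μ₂) (x + e κ)) - (μ₁ - μ₂) x‖ ≤ m * ((P.L : ℝ) ^ j)⁻¹) →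
      ‖Cnl P.L (1 : Site P.d → Fin P.d → 𝔸ˣ) u₁⁻¹ j μ₁ y - Cnl P.L (1 : Site P.d → Fin P.d → 𝔸ˣ) u₁⁻¹ j μ₂ y‖ ≤ Cl * m)
    (hCreallo : ∀ j, j < k → ∀ y ∈ Λs j, ∀ μ : Site P.d → 𝔸,
      (∀ x : Site P.d, InBox (tlo P.L y j) (thi P.L y j) x → ‖μ x‖ < α₄) →
      (∀ (x : Site P.d) (κ : Fin P.d), InBox (tlo P.L y j) (thi P.L y j) x → InBox (tlo P.L y j) (thi P.L y j) (x + e κ) →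
        ‖cj ((1 : Site P.d → Fin P.d → 𝔸ˣ) x κ) (μ (x + e κ)) - μ x‖ < α₄ * ((P.L : ℝ) ^ j)⁻¹) →
      Cnl P.L (1 : Site P.d → Fin P.d → 𝔸ˣ) u₁⁻¹ j (fun x => -star (μ x)) y = -star (Cnl P.L (1 : Site P.d → Fin P.d → 𝔸ˣ) u₁⁻¹ j μ y))
    -- (D) the torus side: the effective-gauge tower of the charted iterate, the representative, the target
    (W₁ : GaugeField P 0 𝔸ˣ) (κf : (Literature.MathematicalPhysics.QuantumFieldTheory.Balaban1983to89.Site P 0 → 𝔸) → (i : ℕ) → GaugeTransf P i 𝔸ˣ)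
    (rep : Literature.MathematicalPhysics.QuantumFieldTheory.Balaban1983to89.Site P 0 → Site P.d)
    (hrep : ∀ yc ∈ Λs k, ∀ x : Site P.d, InBox (tlo P.L yc k) (thi P.L yc k) x → rep (cover P x) = x)
    (y₀ : Literature.MathematicalPhysics.QuantumFieldTheory.Balaban1983to89.Site P k)
    (th : XSpace P.d k 𝔸) (hτ : B₀' * ‖th‖ < α₄ / 4) (hth : ∀ p, star (th p) = -th p)
    (hthk : ∀ yc ∈ Λs k, th (⟨k, Nat.lt_succ_self k⟩, yc) = mlog ((axialT (dbarIterU k W₁) y₀ (coverAt P k yc) : 𝔸ˣ) : 𝔸))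
    (hthlo : ∀ (j : ℕ) (hj : j < k) (y : Site P.d), y ∈ Λs j → th (⟨j, Nat.lt_succ_of_lt hj⟩, y) = 0)
    (haxT : ∀ yc ∈ Λs k, ‖((axialT (dbarIterU k W₁) y₀ (coverAt P k yc) : 𝔸ˣ) : 𝔸) - 1‖ < 1)
    -- the windows of JOIN-B at the Sect. E sizes (socket letters VERBATIM)
    (ha₁' : α₄ / 4 + B₀' * (Cb + ‖th‖) ≤ 1 / 24) (hb₁' : α₄ / 4 + B₀' * (Cb + ‖th‖) ≤ 1 / 140)
    (hθ : 10 * (α₄ / 4 + B₀' * (Cb + ‖th‖)) * BR ≤ 1 / 2) (hh₀' : B₀' * (Cb + ‖th‖) ≤ 3 * α₄ / 4)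
    (h103 : BG * Mc P.d BR (α₄ / 4 + B₀' * (Cb + ‖th‖)) cA (B₂' * (Cb + ‖th‖)) cDA ≤ α₄ / 4)
    (h106 : BG * Kc P.d BR (α₄ / 4 + B₀' * (Cb + ‖th‖)) cA (B₂' * (Cb + ‖th‖)) cDA (B₂' * (2 * Cl)) (1 + B₀' * (2 * Cl)) (1 + B₀' * (2 * Cl))
      ≤ 1 / 2)
    -- (E) the three top rows in torus letters on the tower box (F2∕F3∕F4-local composed with the oscillation transfer; FILE 3 discharges)
    (hTop121 : ∀ yc ∈ Λs k, ∀ l₀ : Literature.MathematicalPhysics.QuantumFieldTheory.Balaban1983to89.Site P 0 → 𝔸,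
      (∀ x : Site P.d, InBox (tlo P.L yc k) (thi P.L yc k) x → ‖l₀ (cover P x)‖ ≤ α₄) →
      (∀ (x : Site P.d) (κ : Fin P.d), InBox (tlo P.L yc k) (thi P.L yc k) x → InBox (tlo P.L yc k) (thi P.L yc k) (x + e κ) →
        ‖l₀ (cover P (x + e κ)) - l₀ (cover P x)‖ ≤ α₄ * ((P.L : ℝ) ^ k)⁻¹) →
      exp (mlog ((κf l₀ k (coverAt P k yc) : 𝔸ˣ) : 𝔸)) = ((κf l₀ k (coverAt P k yc) : 𝔸ˣ) : 𝔸) ∧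
        ‖mlog ((κf l₀ k (coverAt P k yc) : 𝔸ˣ) : 𝔸) - siteAvgIter k l₀ (coverAt P k yc)‖ ≤ Cb)
    (hTop125 : ∀ yc ∈ Λs k, ∀ (l₁ l₂ : Literature.MathematicalPhysics.QuantumFieldTheory.Balaban1983to89.Site P 0 → 𝔸) (m : ℝ), 0 ≤ m →
      (∀ x : Site P.d, InBox (tlo P.L yc k) (thi P.L yc k) x → ‖l₁ (cover P x)‖ ≤ α₄) →
      (∀ (x : Site P.d) (κ : Fin P.d), InBox (tlo P.L yc k) (thi P.L yc k) x → InBox (tlo P.L yc k) (thi P.L yc k) (x + e κ) →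
        ‖l₁ (cover P (x + e κ)) - l₁ (cover P x)‖ ≤ α₄ * ((P.L : ℝ) ^ k)⁻¹) →
      (∀ x : Site P.d, InBox (tlo P.L yc k) (thi P.L yc k) x → ‖l₂ (cover P x)‖ ≤ α₄) →
      (∀ (x : Site P.d) (κ : Fin P.d), InBox (tlo P.L yc k) (thi P.L yc k) x → InBox (tlo P.L yc k) (thi P.L yc k) (x + e κ) →
        ‖l₂ (cover P (x + e κ)) - l₂ (cover P x)‖ ≤ α₄ * ((P.L : ℝ) ^ k)⁻¹) →
      (∀ x : Site P.d, InBox (tlo P.L yc k) (thi P.L yc k) x → ‖l₁ (cover P x) - l₂ (cover P x)‖ ≤ m) →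
      (∀ (x : Site P.d) (κ : Fin P.d), InBox (tlo P.L yc k) (thi P.L yc k) x → InBox (tlo P.L yc k) (thi P.L yc k) (x + e κ) →
        ‖(l₁ (cover P (x + e κ)) - l₂ (cover P (x + e κ))) - (l₁ (cover P x) - l₂ (cover P x))‖ ≤ m * ((P.L : ℝ) ^ k)⁻¹) →
      ‖(mlog ((κf l₁ k (coverAt P k yc) : 𝔸ˣ) : 𝔸) - siteAvgIter k l₁ (coverAt P k yc)) -
          (mlog ((κf l₂ k (coverAt P k yc) : 𝔸ˣ) : 𝔸) - siteAvgIter k l₂ (coverAt P k yc))‖ ≤ Cl * m)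
    (hTopReal : ∀ yc ∈ Λs k, ∀ l₀ : Literature.MathematicalPhysics.QuantumFieldTheory.Balaban1983to89.Site P 0 → 𝔸,
      (∀ x : Site P.d, InBox (tlo P.L yc k) (thi P.L yc k) x → ‖l₀ (cover P x)‖ ≤ α₄) →
      (∀ (x : Site P.d) (κ : Fin P.d), InBox (tlo P.L yc k) (thi P.L yc k) x → InBox (tlo P.L yc k) (thi P.L yc k) (x + e κ) →
        ‖l₀ (cover P (x + e κ)) - l₀ (cover P x)‖ ≤ α₄ * ((P.L : ℝ) ^ k)⁻¹) →
      mlog ((κf (fun s => -star (l₀ s)) k (coverAt P k yc) : 𝔸ˣ) : 𝔸) - siteAvgIter k (fun s => -star (l₀ s)) (coverAt P k yc) =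
        -star (mlog ((κf l₀ k (coverAt P k yc) : 𝔸ˣ) : 𝔸) - siteAvgIter k l₀ (coverAt P k yc)))
    -- (τ) `τ` tracial and the τ-rows: datum, letters `R`∕`G′` (lit base), `H′`, the target; the family's τ-row split below∕top
    (τ : 𝔸 →L[ℂ] ℂ) (hτtr : ∀ x y : 𝔸, τ (x * y) = τ (y * x))
    (hDAτ : ∀ j, j ≤ k → ∀ x ∈ Ω j, τ (covDivB η (1 : Site P.d → Fin P.d → 𝔸ˣ) A x) = 0)
    (hRτ : ∀ f : Site P.d → 𝔸, (∀ j, j ≤ k → ∀ x ∈ Ω j, τ (f x) = 0) →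
      ∀ j, j ≤ k → ∀ x ∈ Ω j, τ ((f - g (qs (c (q (g f))))) x) = 0)
    (hGτ : ∀ f : Site P.d → 𝔸, (∀ j, j ≤ k → ∀ x ∈ Ω j, τ (f x) = 0) → ∀ x, τ (g f x) = 0)
    (hHτ : ∀ X : XSpace P.d k 𝔸, (∀ p, τ (X p) = 0) → ∀ x, τ (H' X x) = 0)
    (hthτ : ∀ p, τ (th p) = 0)
    (hCτlo : ∀ j, j < k → ∀ y ∈ Λs j, ∀ μ : Site P.d → 𝔸, (∀ x, τ (μ x) = 0) →
      (∀ x : Site P.d, InBox (tlo P.L y j) (thi P.L y j) x → ‖μ x‖ < α₄) →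
      (∀ (x : Site P.d) (κ : Fin P.d), InBox (tlo P.L y j) (thi P.L y j) x → InBox (tlo P.L y j) (thi P.L y j) (x + e κ) →
        ‖cj ((1 : Site P.d → Fin P.d → 𝔸ˣ) x κ) (μ (x + e κ)) - μ x‖ < α₄ * ((P.L : ℝ) ^ j)⁻¹) →
      τ (Cnl P.L (1 : Site P.d → Fin P.d → 𝔸ˣ) u₁⁻¹ j μ y) = 0)
    (hTopTrace : ∀ yc ∈ Λs k, ∀ l₀ : Literature.MathematicalPhysics.QuantumFieldTheory.Balaban1983to89.Site P 0 → 𝔸, (∀ s, τ (l₀ s) = 0) →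
      (∀ x : Site P.d, InBox (tlo P.L yc k) (thi P.L yc k) x → ‖l₀ (cover P x)‖ ≤ α₄) →
      (∀ (x : Site P.d) (κ : Fin P.d), InBox (tlo P.L yc k) (thi P.L yc k) x → InBox (tlo P.L yc k) (thi P.L yc k) (x + e κ) →
        ‖l₀ (cover P (x + e κ)) - l₀ (cover P x)‖ ≤ α₄ * ((P.L : ℝ) ^ k)⁻¹) →
      τ (mlog ((κf l₀ k (coverAt P k yc) : 𝔸ˣ) : 𝔸) - siteAvgIter k l₀ (coverAt P k yc)) = 0) :
    ∃ lam : Site P.d → 𝔸, (∀ x, IsSelfAdjoint (lam x)) ∧ (∀ x, x ∉ Ω 0 → lam x = 0) ∧ (∀ x, τ (lam x) = 0) ∧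
      (∀ j, j ≤ k → ∀ p ∈ Eb j, ‖lam p.1‖ ≤ α₄ ∧ wt P.L η j * ‖covDerivFwd η (1 : Site P.d → Fin P.d → 𝔸ˣ) p.2 lam p.1‖ ≤ α₄) ∧
      (∃ μ : ℕ → Site P.d → 𝔸, ∀ x ∈ Ω 0,
        covLap η (1 : Site P.d → Fin P.d → 𝔸ˣ) ((Ω 0).indicator fun y =>
          covDivB η (1 : Site P.d → Fin P.d → 𝔸ˣ) A y + covLap η (1 : Site P.d → Fin P.d → 𝔸ˣ) lam y +
          ((conjR (gaugeExp lam y)⁻¹ (covDivB η (1 : Site P.d → Fin P.d → 𝔸ˣ) A y) - covDivB η (1 : Site P.d → Fin P.d → 𝔸ˣ) A y) +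
            (gAd (covLap η (1 : Site P.d → Fin P.d → 𝔸ˣ) lam y) (lam y) - covLap η (1 : Site P.d → Fin P.d → 𝔸ˣ) lam y) +
            ∑ μ, frakF3 η (1 : Site P.d → Fin P.d → 𝔸ˣ) lam A y μ)) x = QT P.L k Λs (1 : Site P.d → Fin P.d → 𝔸ˣ) μ x) ∧
      (∀ j, j < k → ∀ y ∈ Λs j, Qnl P.L (1 : Site P.d → Fin P.d → 𝔸ˣ) (fun x => expUnit (((-I) • lam) x)) u₁⁻¹ j y = 0) ∧
      (∀ yc ∈ Λs k, κf (((-I) • lam) ∘ rep) k (coverAt P k yc) = axialT (dbarIterU k W₁) y₀ (coverAt P k yc)) := by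
  have hL : 1 ≤ P.L := P.L_pos
  -- the instance: N05's linear functional, the lower∕top split of the family and of the full functional
  let Qlin : ℕ → (Site P.d → 𝔸) → Site P.d → 𝔸 := fun j μ y =>
    QprimeIter (zdBlocking P.d P.L) (bgT P.L (1 : Site P.d → Fin P.d → 𝔸ˣ)) j μ y
  let Ctop : (Site P.d → 𝔸) → Site P.d → 𝔸 := fun μ yc =>
    mlog ((κf (μ ∘ rep) k (coverAt P k yc) : 𝔸ˣ) : 𝔸) - siteAvgIter k (μ ∘ rep) (coverAt P k yc)
  let Cfam : ℕ → (Site P.d → 𝔸) → Site P.d → 𝔸 := fun j μ y =>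
    if j < k then Cnl P.L (1 : Site P.d → Fin P.d → 𝔸ˣ) u₁⁻¹ j μ y else Ctop μ y
  let Qfull : ℕ → (Site P.d → 𝔸) → Site P.d → 𝔸 := fun j μ y =>
    if j < k then Qnl P.L (1 : Site P.d → Fin P.d → 𝔸ˣ) (fun x => expUnit (μ x)) u₁⁻¹ j y
    else mlog ((κf (μ ∘ rep) k (coverAt P k y) : 𝔸ˣ) : 𝔸)
  -- the top-box hypotheses of the socket, transported to the torus field `μ ∘ rep` through `hrep` (`cj 1 = id`)
  have trb : ∀ yc ∈ Λs k, ∀ (μ : Site P.d → 𝔸) (t : ℝ),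
      (∀ x : Site P.d, InBox (tlo P.L yc k) (thi P.L yc k) x → ‖μ x‖ < t) →
      ∀ x : Site P.d, InBox (tlo P.L yc k) (thi P.L yc k) x → ‖(μ ∘ rep) (cover P x)‖ ≤ t := by
    intro yc hyc μ t hb x hx
    rw [Function.comp_apply, hrep yc hyc x hx]; exact (hb x hx).le
  have trb' : ∀ yc ∈ Λs k, ∀ (μ : Site P.d → 𝔸) (t : ℝ),
      (∀ x : Site P.d, InBox (tlo P.L yc k) (thi P.L yc k) x → ‖μ x‖ ≤ t) →
      ∀ x : Site P.d, InBox (tlo P.L yc k) (thi P.L yc k) x → ‖(μ ∘ rep) (cover P x)‖ ≤ t := by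
    intro yc hyc μ t hb x hx
    rw [Function.comp_apply, hrep yc hyc x hx]; exact hb x hx
  have tra : ∀ yc ∈ Λs k, ∀ (μ : Site P.d → 𝔸) (t : ℝ),
      (∀ (x : Site P.d) (κ : Fin P.d), InBox (tlo P.L yc k) (thi P.L yc k) x → InBox (tlo P.L yc k) (thi P.L yc k) (x + e κ) →
        ‖cj ((1 : Site P.d → Fin P.d → 𝔸ˣ) x κ) (μ (x + e κ)) - μ x‖ < t) →
      ∀ (x : Site P.d) (κ : Fin P.d), InBox (tlo P.L yc k) (thi P.L yc k) x → InBox (tlo P.L yc k) (thi P.L yc k) (x + e κ) →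
        ‖(μ ∘ rep) (cover P (x + e κ)) - (μ ∘ rep) (cover P x)‖ ≤ t := by
    intro yc hyc μ t ha x κ hx hxe
    have h := ha x κ hx hxe
    rw [Pi.one_apply, Pi.one_apply, cj_one_apply] at h
    rw [Function.comp_apply, Function.comp_apply, hrep yc hyc _ hxe, hrep yc hyc x hx]; exact h.le
  have tra' : ∀ yc ∈ Λs k, ∀ (μ : Site P.d → 𝔸) (t : ℝ),
      (∀ (x : Site P.d) (κ : Fin P.d), InBox (tlo P.L yc k) (thi P.L yc k) x → InBox (tlo P.L yc k) (thi P.L yc k) (x + e κ) →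
        ‖cj ((1 : Site P.d → Fin P.d → 𝔸ˣ) x κ) (μ (x + e κ)) - μ x‖ ≤ t) →
      ∀ (x : Site P.d) (κ : Fin P.d), InBox (tlo P.L yc k) (thi P.L yc k) x → InBox (tlo P.L yc k) (thi P.L yc k) (x + e κ) →
        ‖(μ ∘ rep) (cover P (x + e κ)) - (μ ∘ rep) (cover P x)‖ ≤ t := by
    intro yc hyc μ t ha x κ hx hxe
    have h := ha x κ hx hxe
    rw [Pi.one_apply, Pi.one_apply, cj_one_apply] at h
    rw [Function.comp_apply, Function.comp_apply, hrep yc hyc _ hxe, hrep yc hyc x hx]; exact h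
  -- the (S2) dictionary at the top index sites
  have hS2 : ∀ yc ∈ Λs k, ∀ μ : Site P.d → 𝔸,
      siteAvgIter k (μ ∘ rep) (coverAt P k yc) = QprimeIter (zdBlocking P.d P.L) (bgT P.L (1 : Site P.d → Fin P.d → 𝔸ˣ)) k μ yc := by
    intro yc hyc μ
    exact siteAvgIter_comp_rep_coverAt_eq_qprimeIter hk μ rep yc fun x hx =>
      hrep yc hyc x ((inBox_tlo_thi_iff_mem_blockSites hL k yc x).2 hx)
  -- the family's rows: lower levels = N05's, top = the torus rows through the dictionary
  have h121 : ∀ j, j ≤ k → ∀ y ∈ Λs j, ∀ μ : Site P.d → 𝔸,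
      (∀ x : Site P.d, InBox (tlo P.L y j) (thi P.L y j) x → ‖μ x‖ < α₄) →
      (∀ (x : Site P.d) (κ : Fin P.d), InBox (tlo P.L y j) (thi P.L y j) x → InBox (tlo P.L y j) (thi P.L y j) (x + e κ) →
        ‖cj ((1 : Site P.d → Fin P.d → 𝔸ˣ) x κ) (μ (x + e κ)) - μ x‖ < α₄ * ((P.L : ℝ) ^ j)⁻¹) →
      ‖Cfam j μ y‖ ≤ Cb := by
    intro j hj y hy μ hb ha
    by_cases hjk : j < k
    · simp only [Cfam, hjk, if_true]; exact hC121lo j hjk y hy μ hb ha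
    · obtain rfl : j = k := le_antisymm hj (not_lt.1 hjk)
      simp only [Cfam, lt_irrefl, if_false, Ctop]
      exact (hTop121 y hy (μ ∘ rep) (trb y hy μ _ hb) (tra y hy μ _ ha)).2
  have h125 : ∀ j, j ≤ k → ∀ y ∈ Λs j, ∀ (μ₁ μ₂ : Site P.d → 𝔸) (m : ℝ), 0 ≤ m →
      (∀ x : Site P.d, InBox (tlo P.L y j) (thi P.L y j) x → ‖μ₁ x‖ < α₄) →
      (∀ (x : Site P.d) (κ : Fin P.d), InBox (tlo P.L y j) (thi P.L y j) x → InBox (tlo P.L y j) (thi P.L y j) (x + e κ) →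
        ‖cj ((1 : Site P.d → Fin P.d → 𝔸ˣ) x κ) (μ₁ (x + e κ)) - μ₁ x‖ < α₄ * ((P.L : ℝ) ^ j)⁻¹) →
      (∀ x : Site P.d, InBox (tlo P.L y j) (thi P.L y j) x → ‖μ₂ x‖ < α₄) →
      (∀ (x : Site P.d) (κ : Fin P.d), InBox (tlo P.L y j) (thi P.L y j) x → InBox (tlo P.L y j) (thi P.L y j) (x + e κ) →
        ‖cj ((1 : Site P.d → Fin P.d → 𝔸ˣ) x κ) (μ₂ (x + e κ)) - μ₂ x‖ < α₄ * ((P.L : ℝ) ^ j)⁻¹) →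
      (∀ x : Site P.d, InBox (tlo P.L y j) (thi P.L y j) x → ‖(μ₁ - μ₂) x‖ ≤ m) →
      (∀ (x : Site P.d) (κ : Fin P.d), InBox (tlo P.L y j) (thi P.L y j) x → InBox (tlo P.L y j) (thi P.L y j) (x + e κ) →
        ‖cj ((1 : Site P.d → Fin P.d → 𝔸ˣ) x κ) ((μ₁ - μ₂) (x + e κ)) - (μ₁ - μ₂) x‖ ≤ m * ((P.L : ℝ) ^ j)⁻¹) →
      ‖Cfam j μ₁ y - Cfam j μ₂ y‖ ≤ Cl * m := by
    intro j hj y hy μ₁ μ₂ m hm h1b h1a h2b h2a hmb hma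
    by_cases hjk : j < k
    · simp only [Cfam, hjk, if_true]; exact hC125lo j hjk y hy μ₁ μ₂ m hm h1b h1a h2b h2a hmb hma
    · obtain rfl : j = k := le_antisymm hj (not_lt.1 hjk)
      simp only [Cfam, lt_irrefl, if_false, Ctop]
      have hmb' : ∀ x : Site P.d, InBox (tlo P.L y j) (thi P.L y j) x → ‖(μ₁ ∘ rep) (cover P x) - (μ₂ ∘ rep) (cover P x)‖ ≤ m := by
        intro x hx
        have h := trb' y hy (μ₁ - μ₂) m hmb x hx
        simpa only [Function.comp_apply, Pi.sub_apply] using h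
      have hma' : ∀ (x : Site P.d) (κ : Fin P.d), InBox (tlo P.L y j) (thi P.L y j) x → InBox (tlo P.L y j) (thi P.L y j) (x + e κ) →
          ‖((μ₁ ∘ rep) (cover P (x + e κ)) - (μ₂ ∘ rep) (cover P (x + e κ))) - ((μ₁ ∘ rep) (cover P x) - (μ₂ ∘ rep) (cover P x))‖ ≤
            m * ((P.L : ℝ) ^ j)⁻¹ := by
        intro x κ hx hxe
        have h := tra' y hy (μ₁ - μ₂) (m * ((P.L : ℝ) ^ j)⁻¹) hma x κ hx hxe
        simpa only [Function.comp_apply, Pi.sub_apply] using h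
      exact hTop125 y hy (μ₁ ∘ rep) (μ₂ ∘ rep) m hm (trb y hy μ₁ _ h1b) (tra y hy μ₁ _ h1a) (trb y hy μ₂ _ h2b) (tra y hy μ₂ _ h2a)
        hmb' hma'
  have hreal : ∀ j, j ≤ k → ∀ y ∈ Λs j, ∀ μ : Site P.d → 𝔸,
      (∀ x : Site P.d, InBox (tlo P.L y j) (thi P.L y j) x → ‖μ x‖ < α₄) →
      (∀ (x : Site P.d) (κ : Fin P.d), InBox (tlo P.L y j) (thi P.L y j) x → InBox (tlo P.L y j) (thi P.L y j) (x + e κ) →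
        ‖cj ((1 : Site P.d → Fin P.d → 𝔸ˣ) x κ) (μ (x + e κ)) - μ x‖ < α₄ * ((P.L : ℝ) ^ j)⁻¹) →
      Cfam j (fun x => -star (μ x)) y = -star (Cfam j μ y) := by
    intro j hj y hy μ hb ha
    by_cases hjk : j < k
    · simp only [Cfam, hjk, if_true]; exact hCreallo j hjk y hy μ hb ha
    · obtain rfl : j = k := le_antisymm hj (not_lt.1 hjk)
      simp only [Cfam, lt_irrefl, if_false, Ctop]
      exact hTopReal y hy (μ ∘ rep) (trb y hy μ _ hb) (tra y hy μ _ ha)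
  -- the split `Qfull = Qlin + Cfam` ((1.113): definitional below the top, (S2) at the top), additivity, the kernel row
  have h213 : ∀ (j : ℕ), j ≤ k → ∀ y ∈ Λs j, ∀ μ : Site P.d → 𝔸, Qfull j μ y = Qlin j μ y + Cfam j μ y := by
    intro j hj y hy μ
    by_cases hjk : j < k
    · simp only [Qfull, Cfam, Qlin, hjk, if_true, Cnl]
      abel
    · obtain rfl : j = k := le_antisymm hj (not_lt.1 hjk)
      simp only [Qfull, Cfam, Qlin, lt_irrefl, if_false, Ctop]
      rw [hS2 y hy μ]
      abel
  have hlin : ∀ (j : ℕ) (μ₁ μ₂ : Site P.d → 𝔸) (y : Site P.d), Qlin j (μ₁ - μ₂) y = Qlin j μ₁ y - Qlin j μ₂ y :=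
    fun j μ₁ μ₂ y => qprimeIter_sub _ _ j μ₁ μ₂ y
  have hQlin0 : ∀ lam : Site P.d → 𝔸, q lam = 0 → ∀ (j : ℕ), j ≤ k → ∀ y ∈ Λs j, Qlin j ((-I) • lam) y = 0 := by
    intro lam hq0 j hj y hy
    show QprimeIter (zdBlocking P.d P.L) (bgT P.L (1 : Site P.d → Fin P.d → 𝔸ˣ)) j ((-I) • lam) y = 0
    rw [← hq ((-I) • lam) j hj y hy, map_smul, hq0, smul_zero, Pi.zero_apply, Pi.zero_apply]
  -- the family's τ-row: N05's below the top, the torus row at the top (through `hrep`)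
  have hCτ : ∀ j, j ≤ k → ∀ y ∈ Λs j, ∀ μ : Site P.d → 𝔸, (∀ x, τ (μ x) = 0) →
      (∀ x : Site P.d, InBox (tlo P.L y j) (thi P.L y j) x → ‖μ x‖ < α₄) →
      (∀ (x : Site P.d) (κ : Fin P.d), InBox (tlo P.L y j) (thi P.L y j) x → InBox (tlo P.L y j) (thi P.L y j) (x + e κ) →
        ‖cj ((1 : Site P.d → Fin P.d → 𝔸ˣ) x κ) (μ (x + e κ)) - μ x‖ < α₄ * ((P.L : ℝ) ^ j)⁻¹) →
      τ (Cfam j μ y) = 0 := by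
    intro j hj y hy μ hμ hb ha
    by_cases hjk : j < k
    · simp only [Cfam, hjk, if_true]; exact hCτlo j hjk y hy μ hμ hb ha
    · obtain rfl : j = k := le_antisymm hj (not_lt.1 hjk)
      simp only [Cfam, lt_irrefl, if_false, Ctop]
      exact hTopTrace y hy (μ ∘ rep) (fun s => hμ (rep s)) (trb y hy μ _ hb) (tra y hy μ _ ha)
  -- the socket (trace-free twin)
  obtain ⟨lam, hsa, hsupp, hτ0, h108, hmult, hQ⟩ := hFP_kLevel_family_RD_traceFree (U₀ := (1 : Site P.d → Fin P.d → 𝔸ˣ)) hL hη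
    (fun _ _ => (unitaryUnits 𝔸).one_mem) hEbΩ hEbT g Δ q qs Aw c g_rightΩ c_range hΔ hqs H' hα₄ hB hB₂ hCb hCl hH0 hH1 hH2 hHsupp hHequiv
    Cfam h121 h125 hreal hCbρ hClB th hτ hth Qfull Qlin h213 hlin hQH hQlin0 hBG hBR hcA hcA' hcDA ha₁' hb₁' hθ hh₀' hG hGsupp hGreal hRbd
    hRreal hDA hDAsa hA hAsa h103 h106 τ hτtr hDAτ hRτ hGτ hHτ hthτ hCτ
  refine ⟨lam, hsa, hsupp, hτ0, h108, hmult, fun j hj y hy => ?_, fun yc hyc => ?_⟩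
  · -- (lo): below the top the target vanishes
    have h := hQ j hj.le y hy
    simp only [Qfull, hj, if_true, hthlo j hj y hy] at h
    exact h
  · -- (top): both sides are exponentials of their logarithms
    have h := hQ k le_rfl yc hyc
    simp only [Qfull, lt_irrefl, if_false, hthk yc hyc] at h
    -- the box bounds of `(−I)•λ′` from (1.108): sup everywhere, gradient on the top box
    have hsup : ∀ x : Site P.d, ‖((-I) • lam) x‖ ≤ α₄ := by
      intro x
      rw [Pi.smul_apply, norm_smul, norm_neg, Complex.norm_I, one_mul]
      by_cases hx : x ∈ Ω 0
      · exact ((h108 0 (Nat.zero_le k) (x, ⟨0, P.hd⟩) (hEbΩ 0 (Nat.zero_le k) x hx ⟨0, P.hd⟩).1).1)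
      · rw [hsupp x hx, norm_zero]; exact hα₄.le
    have hgrad : ∀ (x : Site P.d) (κ : Fin P.d), InBox (tlo P.L yc k) (thi P.L yc k) x → InBox (tlo P.L yc k) (thi P.L yc k) (x + e κ) →
        ‖cj ((1 : Site P.d → Fin P.d → 𝔸ˣ) x κ) (((-I) • lam) (x + e κ)) - ((-I) • lam) x‖ ≤ α₄ * ((P.L : ℝ) ^ k)⁻¹ := by
      intro x κ hx hxe
      have hE : (x, κ) ∈ Eb k := hEbT k le_rfl yc hyc x κ hx hxe
      have h2 := (h108 k le_rfl (x, κ) hE).2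
      -- `wt L η k · ‖η⁻¹(λ(x+e_κ) − λ x)‖ ≤ α₄` ⇒ `‖λ(x+e_κ) − λ x‖ ≤ α₄ L^{−k}`
      have hLk : (0 : ℝ) < (P.L : ℝ) ^ k := by positivity
      have hcd : covDerivFwd η (1 : Site P.d → Fin P.d → 𝔸ˣ) κ lam x = η⁻¹ • (lam (x + e κ) - lam x) := by
        simp only [covDerivFwd, Pi.one_apply, B7Eq78Linearization.conjR_apply, Units.val_one, inv_one, one_mul, mul_one]
      rw [hcd, norm_smul, Real.norm_of_nonneg (inv_nonneg.2 hη.le), wt] at h2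
      have h3 : ‖lam (x + e κ) - lam x‖ ≤ α₄ * ((P.L : ℝ) ^ k)⁻¹ := by
        rw [le_mul_inv_iff₀ hLk]
        have : (P.L : ℝ) ^ k * η * (η⁻¹ * ‖lam (x + e κ) - lam x‖) = ‖lam (x + e κ) - lam x‖ * (P.L : ℝ) ^ k := by
          field_simp
        linarith [this ▸ h2]
      rw [Pi.one_apply, Pi.one_apply, cj_one_apply, Pi.smul_apply, Pi.smul_apply, ← smul_sub, norm_smul, norm_neg, Complex.norm_I, one_mul]
      exact h3
    have hexpκ := (hTop121 yc hyc (((-I) • lam) ∘ rep) (trb' yc hyc _ _ fun x _ => hsup x) (tra' yc hyc _ _ hgrad)).1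
    have hexpA : exp (mlog ((axialT (dbarIterU k W₁) y₀ (coverAt P k yc) : 𝔸ˣ) : 𝔸)) =
        ((axialT (dbarIterU k W₁) y₀ (coverAt P k yc) : 𝔸ˣ) : 𝔸) := MatrixLog.exp_mlog (haxT yc hyc)
    apply Units.ext
    rw [← hexpκ, h, hexpA]

end Summit.QuantumFields.YangMills.Theorems.P1FlatCoreTopStepTorus

end
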